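import Literature.AlgebraicGeometry.Frobenioids.ArchimedeanTheoremsInstances
import Literature.AlgebraicGeometry.Frobenioids.ArchimedeanPseudoTerminal
import HarnessLib

/-!
# Frobenioids II, Proposition 3.5 (i): a COUNTEREXAMPLE over the base `D := D₀`, `D → D₀` the
# Galois-collapsing functor (abc-iut cell, layer L1; refutation of the typed instance
# `ArchFrd.Prop35i_C` for this base — finding P35i-F1)

Mochizuki, *The geometry of Frobenioids II: poly-Frobenioids*, Kyushu J. Math. **62** (2008) 401–460,
§3, Proposition 3.5 (i), kurims p. 34 (journal pp. 428–429) [cite: MochizukiFrdII2008, Prop 3.5 (i) p.34]: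
"Let `A ∈ Ob(H)`; suppose that `B_D → A_D := Base(A)` is a mono-minimal categorical quotient of `B_D` by a
group `G_D ⊆ Aut_D(B_D)` in `D`. Then there exists a pull-back morphism `B → A` that lifts `B_D → A_D`
and a group `G ⊆ Aut_H(B)` that maps isomorphically to `G_D` such that `B → A` is a mono-minimal
categorical quotient of `B` by `G` in `H`" — for `H = C = C₀ ×_{D₀} D` over ANY connected, totally
epimorphic `D` with a functor `D → D₀` (Ex. 3.3 (i), p. 28), `D` of RC-iso-subanchor type.

PROVED here: the typed instance `ArchFrd.Prop35i_C π` (abc-iut-L1-t9, `ArchimedeanTheoremsInstances.lean`,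
schema `ArchFrd.Prop35i` p405564) is FALSE for the base `D := D₀` — connected and totally epimorphic
(`ArchFrd.D0.isGraphConnected`, `ArchFrd.D0.isTotallyEpimorphic`) — equipped with the functor
`π := ArchFrd.D0.collapse : D₀ → D₀` that is the identity on objects and on `Spec ℂ → Spec ℝ` but sends
complex conjugation to the identity (a legitimate, non-faithful functor): `not_prop35i_C_collapse`.
`D₀` is of RC-iso-subanchor type for this functor (`isOfRCIsoSubanchorType_collapse`: `Spec ℂ` is an
RC-anchor, `Spec ℂ → Spec ℝ` is a mono-minimal categorical quotient of `Spec ℂ` by `Gal(ℂ/ℝ)`), and with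
`A := (Spec ℝ, unit isotropic region)` over `A_D := Spec ℝ`, `B_D := Spec ℂ`, `G_D := Aut(Spec ℂ)`,
`B_D → A_D := (Spec ℂ → Spec ℝ)` every datum `(B, f, e, Γ, φ)` as in the conclusion fails to be a
categorical quotient in `C`: the image of `G_D` under `π` is trivial, so (by the compatibility square of
arrows of `C₀ ×_{D₀} D`) every `γ ∈ Γ` has `C₀`-component with `Base = id`, whence the arrow
`ψ := ((Base f₀, deg f₀, i · c_{f₀}), f_D) : B → A` (same data as `f` but scalar multiplied by `i`; it is an
arrow because `A_D` real forces `B` complex and the region of `A` is isotropic) is `Γ`-invariant exactly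
as `f` is; a factorisation `ψ = f ≫ ψ'` would need an endomorphism `ψ'` of the REAL object `A` with scalar
`i ∉ ℝ^×`. WHERE PRINT SLIPS (p. 34): "it follows again from the simple, explicit structure of `H₀` … that
`B → A` is a categorical quotient of `B` by `G` in `H`" uses that `Γ`-invariance forces REAL scalars on
arrows from the complex `B` to real objects, i.e. that some element of `G_D` maps to complex conjugation
in `Aut_{D₀}(Spec ℂ)`; this holds when `A_D` is complex or `B_D` is real (so the use of (i) in the proof of
(ii), which concerns non-isotropic — "hence necessarily complex" — `A`, is unaffected), and is the extra
hypothesis under which (i) is repaired (`Prop35iR`, separate file). FINDING about one printed item; no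
side is taken on [IUTchIII] Cor. 3.12; typed ≠ proved except where a `theorem` says so.
-/

namespace Literature.AlgebraicGeometry.Frobenioids

open CategoryTheory
open scoped Pointwise

noncomputable section

namespace ArchFrd

namespace D0

/-! ### The Galois-collapsing endofunctor of `D₀` -/

/-- On arrows: identity on `Spec ℝ → Spec ℝ` and `Spec ℂ → Spec ℝ`, and EVERY element of `Gal(ℂ/ℝ)` to the
identity of `Spec ℂ`. [cite: MochizukiFrdII2008, Ex 3.3 (i) p.28] -/
def collapseMap : {K L : D0} → (K ⟶ L) → (K ⟶ L)
  | _, _, Hom.idReal => Hom.idReal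
  | _, _, Hom.toReal => Hom.toReal
  | _, _, Hom.gal _ => Hom.gal false

/-- **The Galois-collapsing functor `π : D₀ → D₀`**: the identity on objects, killing complex conjugation
("`D → D₀` is a functor", Ex. 3.3 (i) p. 28 — any functor is allowed; this one is not faithful).
[cite: MochizukiFrdII2008, Ex 3.3 (i) p.28] -/
def collapse : D0 ⥤ D0 where
  obj K := K
  map f := collapseMap f
  map_id K := by cases K <;> rfl
  map_comp f g := by
    cases f <;> cases g
    · rfl
    · rfl
    · rfl
    · change Hom.gal false = Hom.gal (xor false false)
      rfl

/-- `π` is the identity on objects. [cite: MochizukiFrdII2008, Ex 3.3 (i) p.28] -/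
@[simp] theorem collapse_obj (K : D0) : collapse.obj K = K := rfl

/-- `π` sends every endomorphism (in particular complex conjugation) to the identity.
[cite: MochizukiFrdII2008, Ex 3.3 (i) p.28] -/
theorem collapse_map_endo {K : D0} (f : K ⟶ K) : collapse.map f = 𝟙 (collapse.obj K) := by
  cases K <;> cases f <;> rfl

/-- Every arrow of `D₀` into `Spec ℂ` is an isomorphism (an element of `Gal(ℂ/ℝ)`).
[cite: MochizukiFrdII2008, §3 p.23] -/
theorem isIso_of_isComplex_target {K L : D0} (f : K ⟶ L) (hL : L.IsComplex) : IsIso f := by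
  cases f with
  | idReal => exact absurd hL (by decide)
  | toReal => exact absurd hL (by decide)
  | gal σ =>
    refine ⟨⟨Hom.gal σ, ?_, ?_⟩⟩
    · cases σ <;> rfl
    · cases σ <;> rfl

/-- Complex conjugation as an element of `Aut_{D₀}(Spec ℂ)`. [cite: MochizukiFrdII2008, Def 3.1 (i) p.23] -/
def conjAut : Aut complex := ⟨conj, conj, conj_comp_conj, conj_comp_conj⟩

/-- **`Spec ℂ → Spec ℝ` is a mono-minimal categorical quotient of `Spec ℂ` by `Aut(Spec ℂ) = Gal(ℂ/ℝ)` in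
`D₀`** ([FrdI] §0): every arrow `Spec ℂ → X` invariant under conjugation has `X = Spec ℝ` and factors
uniquely; a monomorphism of `D₀` is an isomorphism (`isIso_of_mono`). [cite: MochizukiFrdI2008, §0 p.18] -/
theorem isMonoMinimalQuotient_top_toRealHom :
    IsMonoMinimalQuotient (⊤ : Subgroup (Aut complex)) toRealHom := by
  refine ⟨⟨fun γ _ => Subsingleton.elim _ _, ?_⟩, ?_⟩
  · intro X ψ hψ
    cases X with
    | real => exact ⟨𝟙 _, Subsingleton.elim _ _, fun _ _ => Subsingleton.elim _ _⟩
    | complex =>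
      exfalso
      have h : conj ≫ ψ = ψ := hψ conjAut (Subgroup.mem_top _)
      rcases hom_complex_complex_eq ψ with hψ' | hψ'
      · rw [hψ', Category.comp_id] at h
        exact conj_ne_id h
      · rw [hψ', conj_comp_conj] at h
        exact conj_ne_id h.symm
  · intro A' ζ φ' _ hmono _
    exact isIso_of_mono ζ

/-! ### `D₀` is of RC-iso-subanchor type for the collapsing functor -/

/-- `Spec ℂ` is an RC-anchor of `D₀` (for any `D₀ → D₀` that is the identity on objects): every arrow of
`D₀[ℂ]` is an isomorphism, so no irreducible arrow leaves `Spec ℂ`. [cite: MochizukiFrdII2008, Def 3.1 (v) p.25] -/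
theorem isRCAnchor_complex_collapse : RC.IsRCAnchor (collapse ⋙ toArchBase) complex := by
  refine ⟨(isComplex_toArchBase_iff complex).mpr rfl, ?_⟩
  refine Set.Finite.subset (Set.finite_empty) ?_
  rintro x ⟨f, hf, -⟩
  exfalso
  apply hf.1
  have hc : f.right.obj.IsComplex := (isComplex_toArchBase_iff f.right.obj).mp f.right.property
  haveI : IsIso ((RC.complexObjects (collapse ⋙ toArchBase)).ι.map f.hom) :=
    isIso_of_isComplex_target f.hom.hom hc
  exact isIso_of_fully_faithful (RC.complexObjects (collapse ⋙ toArchBase)).ι f.hom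

/-- `Spec ℂ` is an RC-subanchor. [cite: MochizukiFrdII2008, Def 3.1 (v) p.25] -/
theorem isRCSubanchor_complex_collapse : RC.IsRCSubanchor (collapse ⋙ toArchBase) complex :=
  ⟨complex, isRCAnchor_complex_collapse, ⟨𝟙 _⟩⟩

/-- **`D₀` with the collapsing functor is of RC-iso-subanchor type**: `Spec ℂ` via the identity (quotient
by the trivial group), `Spec ℝ` via `Spec ℂ → Spec ℝ` (quotient by `Gal(ℂ/ℝ)`).
[cite: MochizukiFrdII2008, Def 3.1 (v) p.25] -/
theorem isOfRCIsoSubanchorType_collapse : RC.IsOfRCIsoSubanchorType (collapse ⋙ toArchBase) := by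
  refine ⟨fun K => ?_⟩
  cases K with
  | real =>
    exact ⟨complex, ⊤, toRealHom, isRCSubanchor_complex_collapse, isMonoMinimalQuotient_top_toRealHom⟩
  | complex =>
    exact ⟨complex, ⊥, 𝟙 complex, isRCSubanchor_complex_collapse,
      isTotallyEpimorphic.isMonoMinimalQuotient_bot_of_isIso (𝟙 complex)⟩

end D0

/-! ### The refutation -/

/-- The scalar `i` as a unit of `ℂ`. [cite: MochizukiFrdII2008, Ex 3.3 (i) p.27] -/
abbrev unitI : ℂˣ := Units.mk0 Complex.I Complex.I_ne_zero

/-- `|i| = 1` in the language of `absHom`. [cite: MochizukiFrdII2008, Def 3.1 (ii) p.23] -/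
theorem absHom_unitI : absHom ℂ unitI = 1 :=
  Subtype.ext (by rw [coe_absHom]; simp)

/-- `i` is not a real scalar. [cite: MochizukiFrdII2008, Def 3.1 (ii) p.23] -/
theorem unitI_not_mem_scalars_real : unitI ∉ D0.scalars D0.real := by
  rw [D0.mem_scalars_real_iff]
  simp

/-- **Proposition 3.5 (i) fails for `C₀ ×_{D₀} D₀` over the Galois-collapsing functor**
(finding P35i-F1; see the module docstring for the mathematics).
[cite: MochizukiFrdII2008, Prop 3.5 (i) p.34] -/
theorem not_prop35i_C_collapse :
    ¬ Literature.AlgebraicGeometry.Frobenioids.ArchFrd.Prop35i_C D0.collapse := by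
  intro h
  obtain ⟨B, f, e, Γ, φ, -, -, -, hquot⟩ :=
    h D0.isOfRCIsoSubanchorType_collapse (unitObjOver D0.collapse D0.real) D0.complex D0.toRealHom ⊤
      D0.isMonoMinimalQuotient_top_toRealHom
  obtain ⟨⟨hinv, huniq⟩, -⟩ := hquot
  -- `B` lies over `Spec ℂ`: its `C₀`-component is a complex object
  have hBc : B.fst.base = D0.complex := D0.eq_complex_of_hom_complex (B.iso.hom ≫ e.hom)
  -- notation for the `C₀`-component `f₀ = (b, d, c)` of `f`
  set b := C0.Base f.fst with hb
  set d := C0.degFr f.fst with hd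
  set c := C0.scalar f.fst with hc
  have hiso : (unitObjOver D0.collapse D0.real).fst.region.IsIsotropic :=
    AngularRegion.isIsotropic_isotropicOfTip 1
  -- the arrow `ψ₀ = (b, d, i·c) : B₀ → A₀` of `C₀`
  let ψ₀ : B.fst ⟶ (unitObjOver D0.collapse D0.real).fst :=
    { base := b
      degFr := d
      scalar := unitI * c
      scalar_mem := by
        rw [hBc, D0.scalars_complex]
        exact Subgroup.mem_top _
      mapsTo := by
        have hf := (f.fst).mapsTo
        intro x hx
        obtain ⟨y, hy, rfl⟩ := Set.mem_smul_set.mp hx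
        have hy' : c • y ∈ C0.pullRegion (unitObjOver D0.collapse D0.real).fst b :=
          hf (Set.smul_mem_smul_set hy)
        unfold C0.pullRegion at hy' ⊢
        rw [C0.image_galAct_of_isIsotropic hiso] at hy' ⊢
        rw [C0.mem_carrier_of_isIsotropic hiso] at hy' ⊢
        rw [smul_eq_mul] at hy' ⊢
        rw [mul_assoc, map_mul, absHom_unitI, one_mul]
        exact hy' }
  -- … and the arrow `ψ = (ψ₀, f_D)` of `C`, with the same compatibility square as `f`
  let ψ : B ⟶ unitObjOver D0.collapse D0.real := ⟨ψ₀, f.snd, f.w⟩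
  -- every `γ ∈ Γ` has `C₀`-component over the identity of `D₀` (the image of `Γ` in `D₀` is trivial)
  have hγb : ∀ γ ∈ Γ, C0.Base γ.hom.fst = 𝟙 _ := by
    intro γ _
    have w := γ.hom.w
    rw [D0.collapse_map_endo, Category.comp_id] at w
    exact (cancel_mono B.iso.hom).1 (w.trans (Category.id_comp _).symm)
  -- `ψ` is `Γ`-invariant, exactly as `f` is
  have hψ : ∀ γ ∈ Γ, γ.hom ≫ ψ = ψ := by
    intro γ hγ
    have h1 := hinv γ hγ
    have hfst : γ.hom.fst ≫ f.fst = f.fst := congrArg CFP.Hom.fst h1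
    have hsnd : γ.hom.snd ≫ f.snd = f.snd := congrArg CFP.Hom.snd h1
    have hdeg : C0.degFr γ.hom.fst * d = d := by
      have h2 := congrArg C0.degFr hfst
      rwa [C0.degFr_comp'] at h2
    have hsc : (C0.Base γ.hom.fst).act c * C0.scalar γ.hom.fst ^ (d : ℕ) = c := by
      have h2 := congrArg C0.scalar hfst
      rwa [C0.scalar_comp'] at h2
    rw [hγb γ hγ] at hsc
    unfold D0.Hom.act at hsc
    rw [D0.twists_id, D0.galAct_false] at hsc
    refine CFP.hom_ext (C0.hom_ext ?_ ?_ ?_) hsnd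
    · change C0.Base γ.hom.fst ≫ b = b
      rw [hγb γ hγ, Category.id_comp]
    · change C0.degFr γ.hom.fst * d = d
      exact hdeg
    · change (C0.Base γ.hom.fst).act (unitI * c) * C0.scalar γ.hom.fst ^ (d : ℕ) = unitI * c
      rw [hγb γ hγ]
      unfold D0.Hom.act
      rw [D0.twists_id, D0.galAct_false, mul_assoc, hsc]
  -- but `ψ` does not factor through `f`: the factor would be an endomorphism of the REAL object `A`
  -- with scalar `i`
  obtain ⟨ψ', hψ', -⟩ := huniq ψ hψ
  have hfst : f.fst ≫ ψ'.fst = ψ₀ := congrArg CFP.Hom.fst hψ'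
  have hd1 : C0.degFr ψ'.fst = 1 := by
    have h2 := congrArg C0.degFr hfst
    rw [C0.degFr_comp'] at h2
    change d * C0.degFr ψ'.fst = d at h2
    exact mul_left_cancel (h2.trans (mul_one d).symm)
  have hs : C0.scalar ψ'.fst = unitI := by
    have h2 := congrArg C0.scalar hfst
    rw [C0.scalar_comp', hd1, PNat.one_coe, pow_one] at h2
    change b.act (C0.scalar ψ'.fst) * c = unitI * c at h2
    have hbt : D0.Hom.twists b = false := D0.twists_of_real b
    unfold D0.Hom.act at h2
    rw [hbt, D0.galAct_false] at h2
    exact mul_right_cancel h2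
  have hmem : C0.scalar ψ'.fst ∈ D0.scalars D0.real := ψ'.fst.scalar_mem
  rw [hs] at hmem
  exact unitI_not_mem_scalars_real hmem

/-- **Finding P35i-F1, packaged**: there is a connected, totally epimorphic base `D → D₀` of
RC-iso-subanchor type for which the instance `Prop35i_C` of [FrdII] Prop. 3.5 (i) fails.
[cite: MochizukiFrdII2008, Prop 3.5 (i) p.34] -/
theorem exists_base_not_prop35i_C :
    ∃ π : D0 ⥤ D0, IsGraphConnected D0 ∧ IsTotallyEpimorphic D0 ∧
      RC.IsOfRCIsoSubanchorType (baseRC π) ∧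
        ¬ Literature.AlgebraicGeometry.Frobenioids.ArchFrd.Prop35i_C π :=
  ⟨D0.collapse, D0.isGraphConnected, D0.isTotallyEpimorphic, D0.isOfRCIsoSubanchorType_collapse,
    not_prop35i_C_collapse⟩

end ArchFrd

end

end Literature.AlgebraicGeometry.Frobenioids
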